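import Summits.CriticalPhenomena.PercolationContinuityZ3.Theorems.Transplant.BccSlabCritical
import Summits.CriticalPhenomena.PercolationContinuityZ3.Theorems.Transplant.SqShadowDefs
import Literature.Barriers.CriticalPhenomena.SubexponentialGrowthZdBurtonKeane
import HarnessLib

/-!
# The (001)-slabs `S_k(bcc) = bcc ∩ {0 ≤ x₂ ≤ k}` of the body-centred cubic lattice carry a SQUARE SHADOW
# (`BccSlab.sqShadow k : SqShadow (BccSlab.slabGraph k)`, every `k`) — the input substitution that puts the bcc films
# in the scope of the p205010-free Duminil-Copin–Sidoravicius–Tassion transplant «SqShadow*»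

builds on p205010 (kernel theorem, internal audit signed; external expert review pending) — NOT used in this file (the row BY NAME,
`BccSlab.bccSlab_criticalContinuity` of «BccSlabCritical», goes through p205010; nothing below does).
Lane `prim-bschramm`, seat `prim-bschramm-p2` (gen 45; class C1b = films / other 3D lattices at their own critical point, METHOD = input
substitution; memo `HOME/bschramm/P2-LATTICES.md` §155); helper file (`--supports stmt-CriticalPhenomena-4575 --as helper`).

THE SUBSTITUTION.  In the rotated frame `φ(x) = ((x₀+x₁)/2, (x₀−x₁)/2)` of the tree's bcc skeleton («CubicLatticesSkeleton».`bccSkel`) EVERY bcc bond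
`(±1, ±1, ±1)` projects onto a UNIT AXIS STEP of `ℤ²` (`(σ,σ,τ) ↦ σe₀`, `(σ,−σ,τ) ↦ σe₁`): the slab `S_k(bcc)` is the graph
`{(z, h) : z ∈ ℤ², 0 ≤ h ≤ k, h ≡ z₀ + z₁ (2)}` with `(z, h) ∼ (z ± eᵢ, h ± 1)` — one parity class of the tensor product `ℤ² × P_{k+1}`.  So the
`D₄`-interface «SqShadowDefs».`SqShadow` (bonds ↦ bonds or points of `ℤ²`; finite columns; lifted translations; the quarter turn and a mirror about
a centre lifting to graph automorphisms) is instantiated by `sh = bccSkel`: period `2` (the slab translations `(2(t₀+t₁), 2(t₀−t₁), 0)` shift `φ` by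
`2t`), centre `0`, the quarter turn `x ↦ (−x₁, x₀, x₂)… ` realised as the planar point-group element `(swap, (−1, 1)) ∈ HOct 2` of
«BccPlanarSkeleton».`bccHOctIso` (which fixes `x₂`, hence the slab) and the mirror as `(id, (1, −1))`.
* §1 the shadow `BccSlab.sh`, its axis steps (`sh_step`), finite columns, surjectivity (`k ≥ 1`), injectivity for `k ≤ 1`;
* §2 the lifted translations / quarter turn / mirror of the slab (`shiftIso`, `rotIso`, `reflIso`) and their action on the shadow;
* §3 **`BccSlab.sqShadow k`**;
* §4 scope for Burton–Keane: quasi-transitivity, cubic volume growth, amenability, **`BccSlab.numInfiniteClusters_le_one`** (needs connectedness,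
  supplied by the caller — proved in the sequel «BccSlabSqShadowCritical» together with the connected square lifts and the `θ(p_c) = 0` theorems).
[cite: DuminilCopinSidoraviciusTassion2016, Notation p. 3 and §2; p. 2 "Two generalizations"] [cite: ConwaySloane1999, Ch. 4 §7.1 (bcc = D₃*)]
[cite: BurtonKeane1989, Thm. 2] [cite: LyonsPeres2016, §7.4 and Thm. 7.6]
-/

noncomputable section

namespace Summit.CriticalPhenomena.PercolationContinuityZ3.Theorems.Transplant

namespace BccSlab

open MeasureTheory Literature.Probability.Percolation Literature.Probability.LatticeModels SimpleGraph Filter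
open Literature.Probability.Percolation.GM (HOct sp)
open Literature.Barriers.CriticalPhenomena (IsQuasiTransitive IsGraphAmenable HasExponentialGrowth graphBall ballVolume graphBall_finite
  hasExponentialGrowth_of_not_isGraphAmenable BurtonKeane1989_atMostOneInfiniteCluster_holds)
open scoped Classical

variable {k : ℕ}

/-! ## §1 The shadow: the rotated skeleton restricted to the slab -/

/-- **The square shadow of a slab vertex**: `φ(x) = ((x₀+x₁)/2, (x₀−x₁)/2) ∈ ℤ²` (the tree's `bccSkel`). [cite: ConwaySloane1999, Ch. 4 §7.1] -/
def sh (x : bslab k) : Site 2 := bccSkel (x : bccSite)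

/-- `sh` is `bccSkel` of the underlying bcc site. [folklore] -/
theorem sh_eq (x : bslab k) : sh x = bccSkel (x : bccSite) := rfl

/-- Adjacency in the slab is bcc adjacency of the underlying sites. [folklore] -/
theorem slabGraph_adj {x y : bslab k} : (slabGraph k).Adj x y ↔ bccGraph.Adj (x : bccSite) (y : bccSite) := Iff.rfl

/-- **Every bond of the slab projects onto a unit AXIS step of `ℤ²`** (`(σ,σ,τ) ↦ σe₀`, `(σ,−σ,τ) ↦ σe₁`): the projection property of a square shadow,
never the point case. [cite: ConwaySloane1999, Ch. 4 §7.1] -/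
theorem sh_step {x y : bslab k} (h : (slabGraph k).Adj x y) : (zdGraph 2).Adj (sh x) (sh y) := by
  have h' : bccGraph.Adj (x : bccSite) (y : bccSite) := h
  have e0 := bcc_abs_sub_eq_one h' 0
  have e1 := bcc_abs_sub_eq_one h' 1
  have a0 := two_mul_bccSkel_zero (x : bccSite)
  have a1 := two_mul_bccSkel_one (x : bccSite)
  have b0 := two_mul_bccSkel_zero (y : bccSite)
  have b1 := two_mul_bccSkel_one (y : bccSite)
  rw [zdGraph_adj_iff]
  have key : ∀ (i : Fin 2), (sh y i = sh x i + 1 ∧ sh y (1 - i) = sh x (1 - i)) ∨ (sh x i = sh y i + 1 ∧ sh x (1 - i) = sh y (1 - i)) →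
      (sh y = sh x + Pi.single i 1 ∨ sh x = sh y + Pi.single i 1) := by
    intro i hi
    rcases hi with ⟨h1, h2⟩ | ⟨h1, h2⟩
    · left; ext j
      by_cases hj : j = i
      · subst hj; rw [Pi.add_apply, Pi.single_eq_same, h1]
      · rw [Pi.add_apply, Pi.single_eq_of_ne hj, add_zero]
        have : j = 1 - i := by fin_cases i <;> fin_cases j <;> simp_all
        rw [this, h2]
    · right; ext j
      by_cases hj : j = i
      · subst hj; rw [Pi.add_apply, Pi.single_eq_same, h1]
      · rw [Pi.add_apply, Pi.single_eq_of_ne hj, add_zero]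
        have : j = 1 - i := by fin_cases i <;> fin_cases j <;> simp_all
        rw [this, h2]
  simp only [sh_eq] at key ⊢
  rcases (abs_eq (by norm_num : (0 : ℤ) ≤ 1)).1 e0 with h0 | h0 <;> rcases (abs_eq (by norm_num : (0 : ℤ) ≤ 1)).1 e1 with h1 | h1
  · exact ⟨0, key 0 (Or.inr ⟨by omega, by simp only [Fin.isValue, sub_zero]; omega⟩)⟩
  · exact ⟨1, key 1 (Or.inr ⟨by omega, by simp only [Fin.isValue, sub_self]; omega⟩)⟩
  · exact ⟨1, key 1 (Or.inl ⟨by omega, by simp only [Fin.isValue, sub_self]; omega⟩)⟩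
  · exact ⟨0, key 0 (Or.inl ⟨by omega, by simp only [Fin.isValue, sub_zero]; omega⟩)⟩

/-- The sup-norm form: each shadow coordinate moves by at most one along a bond. [folklore] -/
theorem abs_sh_sub_le_one {x y : bslab k} (h : (slabGraph k).Adj x y) (i : Fin 2) : |sh x i - sh y i| ≤ 1 :=
  bccSkel_lipschitz h i

/-- A slab vertex is determined by its shadow and its height. [folklore] -/
theorem eq_of_sh_eq_of_height_eq {x y : bslab k} (hs : sh x = sh y) (hh : ((x : bccSite) : Site 3) 2 = ((y : bccSite) : Site 3) 2) : x = y := by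
  apply Subtype.ext; apply Subtype.ext
  rw [← bccPoint_bccSkel (x : bccSite), ← bccPoint_bccSkel (y : bccSite)]
  change bccPoint (sh x) _ = bccPoint (sh y) _
  rw [hs, hh]

/-- **Finite columns**: the vertices over a shadow point have heights in `[0, k]`, and height + shadow determine the vertex. [folklore] -/
theorem fibre_finite (k : ℕ) (z : Site 2) : {x : bslab k | sh x = z}.Finite := by
  refine Set.Finite.of_finite_image (f := fun x : bslab k => ((x : bccSite) : Site 3) 2) ((Set.finite_Icc (0 : ℤ) k).subset ?_) ?_
  · rintro _ ⟨x, -, rfl⟩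
    exact ⟨(mem_bslab.1 x.2).1, (mem_bslab.1 x.2).2⟩
  · intro x hx y hy hxy
    have hx' : sh x = z := hx
    have hy' : sh y = z := hy
    exact eq_of_sh_eq_of_height_eq (hx'.trans hy'.symm) hxy

/-- The parity constraint of a slab vertex: `φ₀ + φ₁ ≡ x₂ (mod 2)`. [folklore] -/
theorem even_sh_sum_sub_height (x : bslab k) : Even (sh x 0 + sh x 1 - ((x : bccSite) : Site 3) 2) :=
  bcc_even_skelSum_sub_two (x : bccSite)

/-- The explicit slab vertex over `z` at height `c` (when `c ≡ z₀ + z₁ (mod 2)` and `0 ≤ c ≤ k`). [folklore] -/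
def mkV (z : Site 2) (c : ℤ) (hpar : Even (z 0 + z 1 - c)) (h0 : 0 ≤ c) (hk : c ≤ k) : bslab k :=
  ⟨⟨bccPoint z c, bccPoint_mem_bccSite hpar⟩, by rw [mem_bslab]; exact ⟨h0, hk⟩⟩

/-- The shadow of `mkV z c` is `z`. [folklore] -/
@[simp] theorem sh_mkV (z : Site 2) (c : ℤ) (hpar) (h0 : 0 ≤ c) (hk : c ≤ k) : sh (mkV (k := k) z c hpar h0 hk) = z :=
  bccSkel_bccPoint z c _

/-- The height of `mkV z c` is `c`. [folklore] -/
@[simp] theorem height_mkV (z : Site 2) (c : ℤ) (hpar) (h0 : 0 ≤ c) (hk : c ≤ k) : ((mkV (k := k) z c hpar h0 hk : bccSite) : Site 3) 2 = c := rfl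

/-- **Every column is inhabited** (`k ≥ 1`): over `z` sits the vertex of height `0` or `1` according to the parity of `z₀ + z₁`.
[cite: ConwaySloane1999, Ch. 4 §7.1] -/
theorem sh_surjective (hk : 1 ≤ k) : Function.Surjective (sh (k := k)) := by
  intro z
  rcases Int.even_or_odd (z 0 + z 1) with he | ho
  · exact ⟨mkV z 0 (by simpa using he) le_rfl (by positivity), sh_mkV _ _ _ _ _⟩
  · refine ⟨mkV z 1 ?_ zero_le_one (by exact_mod_cast hk), sh_mkV _ _ _ _ _⟩
    obtain ⟨m, hm⟩ := ho
    exact ⟨m, by omega⟩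

/-- **For `k ≤ 1` the shadow is INJECTIVE** (one vertex per column: the heights `0, 1` have different parities) — the bilayer `S_1(bcc)` is the
square lattice drawn diagonally. [folklore] -/
theorem sh_injective (hk : k ≤ 1) : Function.Injective (sh (k := k)) := by
  intro x y hxy
  apply eq_of_sh_eq_of_height_eq hxy
  have px := even_sh_sum_sub_height x
  have py := even_sh_sum_sub_height y
  rw [hxy] at px
  obtain ⟨hx0, hxk⟩ := mem_bslab.1 x.2
  obtain ⟨hy0, hyk⟩ := mem_bslab.1 y.2
  obtain ⟨m, hm⟩ := px
  obtain ⟨n, hn⟩ := py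
  have hk' : (k : ℤ) ≤ 1 := by exact_mod_cast hk
  omega

/-! ## §2 The lifted translations, quarter turn and mirror of the slab -/

/-- The slab translation vector with shadow `2t`: `(2(t₀+t₁), 2(t₀−t₁), 0)`. [folklore] -/
def shiftVec (t : Site 2) : bccSubgroup :=
  ⟨bccPoint ((2 : ℤ) • t) 0, bccPoint_mem_bccSite ⟨t 0 + t 1, by simp only [Pi.smul_apply, smul_eq_mul]; ring⟩⟩

/-- The shadow of the translation vector is `2t`. [folklore] -/
theorem bccSkel_shiftVec (t : Site 2) : bccSkel (⟨(shiftVec t : Site 3), (shiftVec t).2⟩ : bccSite) = (2 : ℤ) • t :=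
  bccSkel_bccPoint _ _ _

/-- Its third coordinate vanishes. [folklore] -/
@[simp] theorem shiftVec_apply_two (t : Site 2) : (shiftVec t : Site 3) 2 = 0 := rfl

/-- **The lifted translation by `2t`** as an automorphism of the slab (a bcc translation with zero third coordinate preserves the slab).
[cite: DuminilCopinSidoraviciusTassion2016, Notation p. 3] -/
def shiftIso (k : ℕ) (t : Site 2) : slabGraph k ≃g slabGraph k :=
  isoInduceTo (bccShift (shiftVec t)) (bslab k) (bslab k) fun v => by
    simp only [mem_bslab, coe_bccShift, Pi.add_apply, shiftVec_apply_two, add_zero]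

/-- The lifted translation shifts the shadow by `2t`. [folklore] -/
theorem sh_shiftIso (k : ℕ) (t : Site 2) (x : bslab k) : sh (shiftIso k t x) = sh x + (2 : ℤ) • t := by
  rw [sh_eq]
  have h1 : ((shiftIso k t x : bslab k) : bccSite) = bccShift (shiftVec t) (x : bccSite) := rfl
  rw [h1, bccSkel_bccShift, ← bccSkel_shiftVec t]
  rfl

/-- The quarter turn `(a, b) ↦ (−b, a)` of the shadow as a planar point-group element: `(swap, (−1, 1)) ∈ HOct 2`. [folklore] -/
def gRot : HOct 2 := (Equiv.swap 0 1, ![-1, 1])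

/-- The mirror `(a, b) ↦ (a, −b)` of the shadow as a planar point-group element: `(id, (1, −1)) ∈ HOct 2`. [folklore] -/
def gRefl : HOct 2 := (Equiv.refl (Fin 2), ![1, -1])

/-- `gRot` acts on `ℤ²` as `sqRot90`. [folklore] -/
theorem sp_gRot (v : Site 2) : sp gRot v = sqRot90 v := by
  ext i
  fin_cases i
  · show sp gRot v 0 = sqRot90 v 0
    rw [sqRot90_apply_zero]
    simp [gRot, Site.signedPerm_apply, Equiv.swap_apply_left]
  · show sp gRot v 1 = sqRot90 v 1
    rw [sqRot90_apply_one]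
    simp [gRot, Site.signedPerm_apply, Equiv.swap_apply_right]

/-- `gRefl` acts on `ℤ²` as `sqFlip`. [folklore] -/
theorem sp_gRefl (v : Site 2) : sp gRefl v = sqFlip v := by
  ext i
  fin_cases i
  · show sp gRefl v 0 = sqFlip v 0
    rw [sqFlip_apply_zero]
    simp [gRefl, Site.signedPerm_apply, Equiv.refl_symm]
  · show sp gRefl v 1 = sqFlip v 1
    rw [sqFlip_apply_one]
    simp [gRefl, Site.signedPerm_apply, Equiv.refl_symm]

/-- **A planar point-group element as an automorphism of the slab** (it fixes the third coordinate). [cite: ConwaySloane1999, Ch. 4 §7.1] -/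
def pointIso (k : ℕ) (g : HOct 2) : slabGraph k ≃g slabGraph k :=
  isoInduceTo (bccHOctIso g) (bslab k) (bslab k) fun v => by
    simp only [mem_bslab, bccHOctIso_apply, bccHOctEquiv_apply_two]

/-- The point-group automorphism acts on the shadow by `sp g`. [folklore] -/
theorem sh_pointIso (k : ℕ) (g : HOct 2) (x : bslab k) : sh (pointIso k g x) = sp g (sh x) := by
  rw [sh_eq]
  have h1 : ((pointIso k g x : bslab k) : bccSite) = bccHOctEquiv g (x : bccSite) := rfl
  rw [h1, bccSkel_bccHOctEquiv]
  rfl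

/-- **The quarter turn of the slab** about the column of the origin. [cite: DuminilCopinSidoraviciusTassion2016, §2 ("the symmetries of the box")] -/
def rotIso (k : ℕ) : slabGraph k ≃g slabGraph k := pointIso k gRot

/-- **The mirror of the slab** in the first shadow axis. [cite: DuminilCopinSidoraviciusTassion2016, §2] -/
def reflIso (k : ℕ) : slabGraph k ≃g slabGraph k := pointIso k gRefl

/-- The quarter turn acts on the shadow by `sqRot90`. [folklore] -/
theorem sh_rotIso (k : ℕ) (x : bslab k) : sh (rotIso k x) = sqRot90 (sh x) := by
  rw [rotIso, sh_pointIso, sp_gRot]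

/-- The mirror acts on the shadow by `sqFlip`. [folklore] -/
theorem sh_reflIso (k : ℕ) (x : bslab k) : sh (reflIso k x) = sqFlip (sh x) := by
  rw [reflIso, sh_pointIso, sp_gRefl]

/-! ## §3 The square shadow of the bcc slab -/

/-- **THE bcc (001)-SLAB OF THICKNESS `k` CARRIES A SQUARE SHADOW** (every `k`): `sh = bccSkel`, period `2`, centre `0`, the quarter turn and the
mirror realised by planar point-group automorphisms fixing `x₂`.  This puts `S_k(bcc)` in the scope of the square DST layer «SqShadow*».
[cite: DuminilCopinSidoraviciusTassion2016, Thm. 1, Notation p. 3, p. 2 "Two generalizations"] [cite: ConwaySloane1999, Ch. 4 §7.1] -/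
def sqShadow (k : ℕ) : SqShadow (slabGraph k) where
  sh := sh
  lip := fun _ _ h => Or.inr (sh_step h)
  fibre := fibre_finite k
  period := 2
  period_pos := Nat.succ_pos 1
  centre := 0
  shift := fun t => ⟨shiftIso k t, fun w => by rw [sh_shiftIso]; norm_num⟩
  rot := ⟨rotIso k, fun w => by rw [sh_rotIso, sub_zero, sub_zero]⟩
  refl := ⟨reflIso k, fun w => by rw [sh_reflIso, sub_zero, sub_zero]⟩

/-- The shadow map of the instance is `sh`. [folklore] -/
@[simp] theorem sqShadow_sh (k : ℕ) : (sqShadow k).sh = sh := rfl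

/-- The centre of the instance is `0`. [folklore] -/
@[simp] theorem sqShadow_centre (k : ℕ) : (sqShadow k).centre = 0 := rfl

/-- The period of the instance is `2`. [folklore] -/
@[simp] theorem sqShadow_period (k : ℕ) : (sqShadow k).period = 2 := rfl

/-! ## §4 Scope for Burton–Keane: quasi-transitivity, cubic growth, amenability, uniqueness -/

/-- The representatives of the translation orbits: vertices with shadow in `{0,1}²` (finitely many: four finite columns). [folklore] -/
theorem finite_reps (k : ℕ) : {x : bslab k | (sh x 0 = 0 ∨ sh x 0 = 1) ∧ (sh x 1 = 0 ∨ sh x 1 = 1)}.Finite := by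
  have hsub : {x : bslab k | (sh x 0 = 0 ∨ sh x 0 = 1) ∧ (sh x 1 = 0 ∨ sh x 1 = 1)} ⊆
      ⋃ z ∈ ({![0, 0], ![0, 1], ![1, 0], ![1, 1]} : Set (Site 2)), {x : bslab k | sh x = z} := by
    intro x hx
    obtain ⟨h0, h1⟩ := hx
    simp only [Set.mem_iUnion, Set.mem_insert_iff, Set.mem_singleton_iff, Set.mem_setOf_eq, exists_prop]
    have hrepr : sh x = ![sh x 0, sh x 1] := by ext i; fin_cases i <;> rfl
    rcases h0 with h0 | h0 <;> rcases h1 with h1 | h1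
    · exact ⟨![0, 0], Or.inl rfl, by rw [hrepr, h0, h1]⟩
    · exact ⟨![0, 1], Or.inr (Or.inl rfl), by rw [hrepr, h0, h1]⟩
    · exact ⟨![1, 0], Or.inr (Or.inr (Or.inl rfl)), by rw [hrepr, h0, h1]⟩
    · exact ⟨![1, 1], Or.inr (Or.inr (Or.inr rfl)), by rw [hrepr, h0, h1]⟩
  refine Set.Finite.subset ?_ hsub
  exact Set.Finite.biUnion (Set.toFinite _) fun z _ => fibre_finite k z

/-- **The slab is quasi-transitive** (the lifted translations by `2ℤ²` have finitely many orbits). [cite: LyonsPeres2016, §7.4] -/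
theorem isQuasiTransitive (k : ℕ) : IsQuasiTransitive (slabGraph k) := by
  refine ⟨(finite_reps k).toFinset, fun x => ?_⟩
  set q0 : ℤ := sh x 0 / 2 with hq0
  set q1 : ℤ := sh x 1 / 2 with hq1
  refine ⟨shiftIso k ![-q0, -q1], ?_⟩
  rw [Set.Finite.mem_toFinset, Set.mem_setOf_eq, sh_shiftIso]
  simp only [Pi.add_apply, Pi.smul_apply, smul_eq_mul, Matrix.cons_val_zero, Matrix.cons_val_one]
  omega

/-- Along a walk of the slab of length `n` the shadow coordinates move by at most `n`. [folklore] -/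
theorem abs_sh_sub_le_length {x y : bslab k} (w : (slabGraph k).Walk x y) (i : Fin 2) : |sh y i - sh x i| ≤ (w.length : ℤ) := by
  induction w with
  | nil => simp
  | @cons a b c hab w ih =>
    have h1 : |sh b i - sh a i| ≤ 1 := by rw [abs_sub_comm]; exact abs_sh_sub_le_one hab i
    have h2 : |sh c i - sh a i| ≤ |sh c i - sh b i| + |sh b i - sh a i| := abs_sub_le _ _ _
    simp only [SimpleGraph.Walk.length_cons, Nat.cast_add, Nat.cast_one]
    linarith

/-- **Cubic volume growth**: `|B(x,n)| ≤ (2n+1)²·(k+1)`. [cite: LyonsPeres2016, §6.1 (growth of balls)] -/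
theorem ballVolume_le (x : bslab k) (n : ℕ) : ballVolume (slabGraph k) x n ≤ (2 * n + 1) ^ 2 * (k + 1) := by
  set f : bslab k → ℤ × ℤ × ℤ := fun y => (sh y 0 - sh x 0, sh y 1 - sh x 1, ((y : bccSite) : Site 3) 2) with hf
  have hinj : Function.Injective f := by
    intro y z h
    simp only [hf, Prod.mk.injEq] at h
    refine eq_of_sh_eq_of_height_eq ?_ h.2.2
    ext i; fin_cases i
    · show sh y 0 = sh z 0; omega
    · show sh y 1 = sh z 1; omega
  set S : Finset (ℤ × ℤ × ℤ) := Finset.Icc (-(n : ℤ)) n ×ˢ (Finset.Icc (-(n : ℤ)) n ×ˢ Finset.Icc (0 : ℤ) k) with hS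
  have hsub : f '' graphBall (slabGraph k) x n ⊆ ↑S := by
    rintro _ ⟨y, ⟨w, hw⟩, rfl⟩
    have h0 := abs_sh_sub_le_length w 0
    have h1 := abs_sh_sub_le_length w 1
    have hn : (w.length : ℤ) ≤ n := by exact_mod_cast hw
    obtain ⟨h3, h4⟩ := mem_bslab.1 y.2
    rw [abs_le] at h0 h1
    simp only [hS, hf, Finset.coe_product, Finset.coe_Icc, Set.mem_prod, Set.mem_Icc]
    refine ⟨⟨?_, ?_⟩, ⟨?_, ?_⟩, h3, h4⟩ <;> linarith
  have hcard : S.card = (2 * n + 1) ^ 2 * (k + 1) := by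
    rw [hS, Finset.card_product, Finset.card_product, Int.card_Icc, Int.card_Icc]
    have e1 : ((n : ℤ) + 1 - -(n : ℤ)).toNat = 2 * n + 1 := by omega
    have e2 : ((k : ℤ) + 1 - 0).toNat = k + 1 := by omega
    rw [e1, e2]; ring
  unfold ballVolume
  rw [← Set.ncard_image_of_injective _ hinj, ← hcard, ← Set.ncard_coe_finset]
  exact Set.ncard_le_ncard hsub S.finite_toSet

/-- Any vertex of the slab (used as the base point of the growth estimate; the origin for every `k`). [folklore] -/
def origin (k : ℕ) : bslab k := mkV 0 0 (by simp) le_rfl (by positivity)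

/-- The slab does not have exponential growth. [cite: Hutchcroft2016, §1 (exponential growth)] -/
theorem not_hasExponentialGrowth (k : ℕ) : ¬ HasExponentialGrowth (slabGraph k) := by
  intro h
  obtain ⟨c, hc, hev⟩ := h (origin k)
  have hev2 := Literature.Barriers.CriticalPhenomena.eventually_pow_lt_const_pow 3 hc
  obtain ⟨n, ⟨hn1, hn2⟩, hnk⟩ := ((hev.and hev2).and (eventually_ge_atTop k)).exists
  have hvol : (ballVolume (slabGraph k) (origin k) n : ℝ) ≤ (2 * n + 1) ^ 2 * (k + 1) := by
    exact_mod_cast ballVolume_le (origin k) n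
  have hk' : ((k : ℝ) + 1) ≤ 2 * n + 1 := by
    have : (k : ℝ) ≤ n := by exact_mod_cast hnk
    linarith
  have hle : ((2 * n + 1 : ℝ)) ^ 2 * (k + 1) ≤ (2 * n + 1) ^ 3 := by
    rw [pow_succ]
    exact mul_le_mul_of_nonneg_left hk' (sq_nonneg _)
  linarith

/-- **The slab is amenable** (subexponential growth + quasi-transitivity). [cite: LyonsPeres2016, §6.1 (p. 279)] -/
theorem isGraphAmenable (k : ℕ) : IsGraphAmenable (slabGraph k) := by
  by_contra h
  exact not_hasExponentialGrowth k (hasExponentialGrowth_of_not_isGraphAmenable _ (isQuasiTransitive k) h)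

/-- **Uniqueness of the infinite cluster on a CONNECTED bcc slab, every density** (Burton–Keane for amenable quasi-transitive graphs; the
connectedness of `S_k(bcc)`, `k ≥ 1`, is proved in «BccSlabSqShadowCritical»). [cite: BurtonKeane1989, Thm. 2] [cite: LyonsPeres2016, Thm. 7.6] -/
theorem numInfiniteClusters_le_one (hc : (slabGraph k).Connected) (p : unitInterval) :
    ∀ᵐ ω ∂(bondPercolation (slabGraph k) p), numInfiniteClusters ω ≤ 1 :=
  BurtonKeane1989_atMostOneInfiniteCluster_holds _ hc (isQuasiTransitive k) (isGraphAmenable k) p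

end BccSlab

end Summit.CriticalPhenomena.PercolationContinuityZ3.Theorems.Transplant

end
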